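import Mathlib
import Summits.ResolutionOfSingularities.ResolutionOfSingularities.Theorems.HomologicalConductorNoZenoCycleLattice
import HarnessLib

/-!
# Rung S-2 `PersistenceSurface` (stmt-ResolutionOfSingularities-19970) — POINTED CYCLES: the lattice half of the
# pointed-cycle ceiling `ca³(T) ⊆ I(Z⁽ᵗ⁾ − A⁽ᵗ⁾)` and of chain-arrival persistence (memo K-PCC, res-L1-w44b-lead-1 g4)

Route `ResolutionOfSingularities/HomologicalConductor`, chain W4.4b (cell `res-hironaka`), rung S-2
`PersistenceSurface` (stmt-ResolutionOfSingularities-19970), registered stub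
`stub_levelFourPersistenceNonnormalOrNonrational'` (C3′, class Σ6 = normal NON-rational stages) and the local
core `stub_localChartPersistenceSurface`.  `[OURS · L1 w44b]` — replaces the role of no printed item; NOT a
statement of the manuscript under review (Hironaka 2017), nothing of it is used; AI-written elementary order
theory / arithmetic, weaker than expert review.  Def-free (predicates are spelled out as hypotheses).

## What the memo K-PCC (evidence #45 on 19970) proves, and what this file types

For a normal surface germ `T` with a resolution `X` whose exceptional curves `C_i` (`i : ι`) have intersection
matrix `M` (`M i j = C_i·C_j ≥ 0` for `i ≠ j`, negative definite), and an exceptional curve `C_t`: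
`𝒫_t = {Z ≥ 0 : Z·C_i ≤ −δ_it ∀ i}` («anti-nef pointed at t»), `𝒜_t = {A ≥ 0 : A·C_i ≥ −δ_it ∀ i}` («almost nef
at t»); the memo shows `ca³(T) ⊆ tr(M_{−δ_t}) ⊆ I(Z⁽ᵗ⁾ − A⁽ᵗ⁾)` with `Z⁽ᵗ⁾ = min 𝒫_t`, `A⁽ᵗ⁾ = max 𝒜_t` (degrees of
restricted line bundles + negative definiteness + tree `TraceIdealBound`), and derives PERSISTENCE AT CHAIN
ARRIVALS: if the arrival `Q ∈ NBl_ca(T)` is the contraction of a chain `S ⊂ X`, `x ∈ ca³(T)` and `A⁽ᵗ⁾ = 0` on `S`,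
then `v_{C_i}(x) ≥ max_{t∈S} Z⁽ᵗ⁾_T(i) ≥ max_t Z⁽ᵗ⁾_S(i)` (RESTRICTION LEMMA) `≥ pyramid(i)` for an `A_ℓ`-path
(PYRAMID LEMMA), i.e. `x ∈ (u,v,w^{⌈ℓ/2⌉}) = ca(A_ℓ)`.  The sheaf half (line bundles, orders along exceptional
curves) is for W4.4's `NoZeno` resolution framework; this file types the VOCABULARY-FREE LATTICE HALF, in the
style of `…NoZenoCycleLattice` (cycles `ι → ℕ`, an abstract integer matrix `M`; the pairing `Z·C_i` is written
`∑ j, (Z j : ℤ) * M j i`, the weight `δ_it` as `if i = t then 1 else 0`; only `M i j ≥ 0` OFF the diagonal is used —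
negative definiteness is not needed for these steps):

* **Artin's min/max lemma** (`sum_inf_mul_le`, `inf_isPointedAntinef`, `sup_isPointedAlmostNef`): `𝒫_t` is
  `⊓`-closed, `𝒜_t` is `⊔`-closed; **least / greatest elements** (`exists_least_of_infClosed`,
  `exists_greatest_of_supClosed`): existence and uniqueness of `Z⁽ᵗ⁾ = min 𝒫_t` and (given the bound `A ≤ D_t` of the
  geometry) of `A⁽ᵗ⁾ = max 𝒜_t`; the abstract NP(t) criterion `greatest_eq_zero_of_apply_eq_zero`;
* **RESTRICTION LEMMA** (memo Lemma 4.1: `sum_indicator_mul_le`, `indicator_isPointedAntinefOn`,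
  `le_of_isPointedAntinef_of_forall_le`): `Z|_S` is pointed anti-nef for the principal submatrix of the contracted
  chain `S`, hence `Z⁽ᵗ⁾_Γ|_S ≥ Z⁽ᵗ⁾_S`;
* **PYRAMID LEMMA for an `A_ℓ`-path** (memo Rem 2.5 / Cor 4.4: `pyramid_le_of_concave_of_corner`): a concave
  integer profile with non-negative ends and a strict corner at a middle index dominates `min(i, ℓ+1−i)`, the cycle
  of `ca(A_ℓ) = (u, v, w^{⌈ℓ/2⌉})` — the chain's «K-S-ii in numbers» threshold is met automatically.

References (mechanism only): M. Artin, Amer. J. Math. 88 (1966) (fundamental cycle; the min-argument);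
J. Lipman, Publ. IHÉS 36 (1969) §12, §18 [`Lipman1969`]; S. B. Iyengar, R. Takahashi, IMRN 2016
[`IyengarTakahashi2014`] (Def. 2.1); this work (memo K-PCC).
-/

-- single-problem summit: the doubled namespace component `ResolutionOfSingularities` is forced
set_option linter.dupNamespace false

namespace Summit.ResolutionOfSingularities.ResolutionOfSingularities.Theorems.HomologicalConductor.PersistencePointedCycles

open Finset
open Summit.ResolutionOfSingularities.ResolutionOfSingularities.Theorems.NoZeno.SandwichCluster.CycleLattice
  (finite_setOf_cycle_le)

/-! ## Artin's min/max lemma for an abstract intersection matrix -/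

section Pairing

variable {ι : Type*} [Fintype ι] [DecidableEq ι]

omit [DecidableEq ι] in
/-- **Artin's min-lemma (one coordinate).** If `M` has non-negative off-diagonal entries and the minimum
`Z ⊓ Z'` agrees with `Z` at `i`, then `(Z ⊓ Z')·C_i ≤ Z·C_i` (the `i`-th terms agree, every other term only
decreases). [cite: Lipman1969, §18 (Artin's argument)] -/
theorem sum_inf_mul_le (M : ι → ι → ℤ) (hoff : ∀ i j, i ≠ j → 0 ≤ M i j) (Z Z' : ι → ℕ) (i : ι)
    (hi : (Z ⊓ Z') i = Z i) : ∑ j, ((Z ⊓ Z') j : ℤ) * M j i ≤ ∑ j, (Z j : ℤ) * M j i := by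
  refine sum_le_sum fun j _ => ?_
  by_cases hji : j = i
  · subst hji; rw [hi]
  · have h1 : ((Z ⊓ Z') j : ℤ) ≤ (Z j : ℤ) := by exact_mod_cast inf_le_left (a := Z j) (b := Z' j)
    exact mul_le_mul_of_nonneg_right h1 (hoff j i hji)

omit [DecidableEq ι] in
/-- **Artin's max-lemma (one coordinate).** Dually, if `Z ⊔ Z'` agrees with `Z` at `i` then `Z·C_i ≤ (Z ⊔ Z')·C_i`.
[cite: Lipman1969, §18 (Artin's argument)] -/
theorem sum_mul_le_sum_sup_mul (M : ι → ι → ℤ) (hoff : ∀ i j, i ≠ j → 0 ≤ M i j) (Z Z' : ι → ℕ) (i : ι)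
    (hi : (Z ⊔ Z') i = Z i) : ∑ j, (Z j : ℤ) * M j i ≤ ∑ j, ((Z ⊔ Z') j : ℤ) * M j i := by
  refine sum_le_sum fun j _ => ?_
  by_cases hji : j = i
  · subst hji; rw [hi]
  · have h1 : (Z j : ℤ) ≤ ((Z ⊔ Z') j : ℤ) := by exact_mod_cast le_sup_left (a := Z j) (b := Z' j)
    exact mul_le_mul_of_nonneg_right h1 (hoff j i hji)

/-- **`𝒫_t` is closed under minima** (Artin): if `Z`, `Z'` are anti-nef pointed at `t` (`Z·C_i ≤ −δ_it`), so is
`Z ⊓ Z'`. [this work] -/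
theorem inf_isPointedAntinef {M : ι → ι → ℤ} (hoff : ∀ i j, i ≠ j → 0 ≤ M i j) (t : ι) {Z Z' : ι → ℕ}
    (hZ : ∀ i, ∑ j, (Z j : ℤ) * M j i ≤ -(if i = t then 1 else 0))
    (hZ' : ∀ i, ∑ j, (Z' j : ℤ) * M j i ≤ -(if i = t then 1 else 0)) :
    ∀ i, ∑ j, ((Z ⊓ Z') j : ℤ) * M j i ≤ -(if i = t then 1 else 0) := by
  intro i
  rcases le_total (Z i) (Z' i) with h | h
  · have hi : (Z ⊓ Z') i = Z i := by simp [h]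
    exact (sum_inf_mul_le M hoff Z Z' i hi).trans (hZ i)
  · have hi : (Z' ⊓ Z) i = Z' i := by simp [h]
    rw [inf_comm]
    exact (sum_inf_mul_le M hoff Z' Z i hi).trans (hZ' i)

/-- **`𝒜_t` is closed under maxima** (Artin, dual form): if `A`, `A'` are almost nef at `t` (`A·C_i ≥ −δ_it`), so is
`A ⊔ A'`. [this work] -/
theorem sup_isPointedAlmostNef {M : ι → ι → ℤ} (hoff : ∀ i j, i ≠ j → 0 ≤ M i j) (t : ι) {A A' : ι → ℕ}
    (hA : ∀ i, -(if i = t then (1 : ℤ) else 0) ≤ ∑ j, (A j : ℤ) * M j i)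
    (hA' : ∀ i, -(if i = t then (1 : ℤ) else 0) ≤ ∑ j, (A' j : ℤ) * M j i) :
    ∀ i, -(if i = t then (1 : ℤ) else 0) ≤ ∑ j, ((A ⊔ A') j : ℤ) * M j i := by
  intro i
  rcases le_total (A' i) (A i) with h | h
  · have hi : (A ⊔ A') i = A i := by simp [h]
    exact (hA i).trans (sum_mul_le_sum_sup_mul M hoff A A' i hi)
  · have hi : (A' ⊔ A) i = A' i := by simp [h]
    rw [sup_comm]
    exact (hA' i).trans (sum_mul_le_sum_sup_mul M hoff A' A i hi)

omit [DecidableEq ι] in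
/-- The zero cycle is almost nef at every `t` (`0·C_i = 0 ≥ −δ_it`), so `𝒜_t ≠ ∅`. [folklore] -/
theorem zero_isPointedAlmostNef (M : ι → ι → ℤ) (t : ι) [DecidableEq ι] :
    ∀ i, -(if i = t then (1 : ℤ) else 0) ≤ ∑ j, ((0 : ι → ℕ) j : ℤ) * M j i := by
  intro i
  simp only [Pi.zero_apply, Nat.cast_zero, zero_mul, sum_const_zero]
  split_ifs <;> norm_num

/-- A cycle anti-nef pointed at `t` is non-zero (`0·C_t = 0 > −1`). [folklore] -/
theorem ne_zero_of_isPointedAntinef {M : ι → ι → ℤ} (t : ι) {Z : ι → ℕ}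
    (hZ : ∀ i, ∑ j, (Z j : ℤ) * M j i ≤ -(if i = t then 1 else 0)) : Z ≠ 0 := by
  rintro rfl
  have h := hZ t
  simp at h

end Pairing

/-! ## Least and greatest elements (`Z⁽ᵗ⁾`, `A⁽ᵗ⁾`) -/

section Extremal

variable {ι : Type*} [Finite ι]

/-- **Least member of a `⊓`-closed non-empty family of cycles** (no up-closure needed): `𝒫 ∩ [0, Z₁]` is finite,
non-empty and `⊓`-closed, so its total minimum `Z₀` lies in `𝒫`, and `Z₀ ≤ Z ⊓ Z₁ ≤ Z` for every `Z ∈ 𝒫`.  With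
`inf_isPointedAntinef` this is the existence of the pointed fundamental cycle `Z⁽ᵗ⁾ = min 𝒫_t` (memo K-PCC Def 2.1).
[this work] -/
theorem exists_least_of_infClosed (P : (ι → ℕ) → Prop) (hinf : ∀ Z Z', P Z → P Z' → P (Z ⊓ Z'))
    (hne : ∃ Z, P Z) : ∃ Z₀, P Z₀ ∧ ∀ Z, P Z → Z₀ ≤ Z := by
  classical
  obtain ⟨Z₁, hZ₁⟩ := hne
  have hfin : {Z | P Z ∧ Z ≤ Z₁}.Finite := (finite_setOf_cycle_le Z₁).subset fun Z hZ => hZ.2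
  set S : Finset (ι → ℕ) := hfin.toFinset with hS
  have hmem : ∀ Z, Z ∈ S ↔ P Z ∧ Z ≤ Z₁ := fun Z => by rw [hS, Set.Finite.mem_toFinset]; rfl
  have hSne : S.Nonempty := ⟨Z₁, (hmem _).2 ⟨hZ₁, le_rfl⟩⟩
  refine ⟨S.inf' hSne id, ?_, fun Z hZ => ?_⟩
  · have h : S.inf' hSne id ∈ (S : Set (ι → ℕ)) :=
      Finset.inf'_mem (s := (S : Set (ι → ℕ)))
        (fun Z hZ Z' hZ' => by
          rw [Finset.mem_coe, hmem] at hZ hZ' ⊢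
          exact ⟨hinf _ _ hZ.1 hZ'.1, inf_le_left.trans hZ.2⟩)
        S hSne id fun Z hZ => by simpa using hZ
    rw [Finset.mem_coe, hmem] at h
    exact h.1
  · exact (Finset.inf'_le id ((hmem _).2 ⟨hinf _ _ hZ hZ₁, inf_le_right⟩)).trans inf_le_left

omit [Finite ι] in
/-- The least member is unique. [folklore] -/
theorem least_unique (P : (ι → ℕ) → Prop) {Z₀ Z₀' : ι → ℕ} (h : P Z₀ ∧ ∀ Z, P Z → Z₀ ≤ Z)
    (h' : P Z₀' ∧ ∀ Z, P Z → Z₀' ≤ Z) : Z₀ = Z₀' :=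
  le_antisymm (h.2 _ h'.1) (h'.2 _ h.1)

/-- **Greatest member of a `⊔`-closed, bounded, non-empty family of cycles.** With `sup_isPointedAlmostNef`,
`zero_isPointedAlmostNef` and the bound `A ≤ D_t` (negative definiteness, memo §2) this is the existence of the
almost-nef excess `A⁽ᵗ⁾ = max 𝒜_t`. [this work] -/
theorem exists_greatest_of_supClosed (P : (ι → ℕ) → Prop) (hsup : ∀ A A', P A → P A' → P (A ⊔ A'))
    (D : ι → ℕ) (hbd : ∀ A, P A → A ≤ D) (hne : ∃ A, P A) : ∃ A₀, P A₀ ∧ ∀ A, P A → A ≤ A₀ := by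
  classical
  have hfin : {A | P A}.Finite := (finite_setOf_cycle_le D).subset fun A hA => hbd A hA
  set S : Finset (ι → ℕ) := hfin.toFinset with hS
  have hmem : ∀ A, A ∈ S ↔ P A := fun A => by rw [hS, Set.Finite.mem_toFinset]; rfl
  obtain ⟨A₁, hA₁⟩ := hne
  have hSne : S.Nonempty := ⟨A₁, (hmem _).2 hA₁⟩
  refine ⟨S.sup' hSne id, ?_, fun A hA => Finset.le_sup' id ((hmem A).2 hA)⟩
  have h : S.sup' hSne id ∈ (S : Set (ι → ℕ)) :=
    Finset.sup'_mem (s := (S : Set (ι → ℕ)))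
      (fun A hA A' hA' => by
        rw [Finset.mem_coe, hmem] at hA hA' ⊢
        exact hsup _ _ hA hA')
      S hSne id fun A hA => by simpa using hA
  rw [Finset.mem_coe, hmem] at h
  exact h

omit [Finite ι] in
/-- The greatest member is unique. [folklore] -/
theorem greatest_unique (P : (ι → ℕ) → Prop) {A₀ A₀' : ι → ℕ} (h : P A₀ ∧ ∀ A, P A → A ≤ A₀)
    (h' : P A₀' ∧ ∀ A, P A → A ≤ A₀') : A₀ = A₀' :=
  le_antisymm (h'.2 _ h.1) (h.2 _ h'.1)

omit [Finite ι] in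
/-- **NP(t) criterion, abstract form** (memo §3(a)): if every non-zero member of `𝒜_t` is `≥ 1` at `t` (in the
geometry: `A² < 0` puts the unique negative pairing at `C_t`, so `C_t ⊆ Supp A`) and the greatest member vanishes
at `t` (e.g. `(D_t)_t < 1`), then the greatest member is `0`: `A⁽ᵗ⁾ = 0`. [this work] -/
theorem greatest_eq_zero_of_apply_eq_zero (P : (ι → ℕ) → Prop) (t : ι) {A₀ : ι → ℕ} (hA₀ : P A₀)
    (hcorner : ∀ A, P A → A ≠ 0 → 1 ≤ A t) (ht : A₀ t = 0) : A₀ = 0 := by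
  by_contra hne
  have := hcorner A₀ hA₀ hne
  omega

end Extremal

/-! ## The restriction lemma (memo K-PCC Lemma 4.1) -/

section Restrict

variable {ι : Type*} [Fintype ι] [DecidableEq ι]

omit [DecidableEq ι] in
/-- **Restriction only lowers the pairing with curves of `S`**: for `i ∈ S`, `(Z|_S)·C_i ≤ Z·C_i`, where
`Z|_S = Set.indicator S Z` keeps the coefficients on `S` and zeroes the others (the dropped `Z_j`, `j ∉ S`, meet `C_i`
non-negatively).  `(Z|_S)·C_i` for `i ∈ S` is the pairing for the PRINCIPAL SUBMATRIX of `S`. [this work] -/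
theorem sum_indicator_mul_le (M : ι → ι → ℤ) (hoff : ∀ i j, i ≠ j → 0 ≤ M i j) (S : Finset ι) (Z : ι → ℕ)
    {i : ι} (hi : i ∈ S) :
    ∑ j, ((Set.indicator (↑S) Z) j : ℤ) * M j i ≤ ∑ j, (Z j : ℤ) * M j i := by
  refine sum_le_sum fun j _ => ?_
  by_cases hj : j ∈ S
  · rw [Set.indicator_of_mem (Finset.mem_coe.2 hj)]
  · have hji : j ≠ i := fun h => hj (h ▸ hi)
    rw [Set.indicator_of_notMem (fun h => hj (Finset.mem_coe.1 h)), Nat.cast_zero, zero_mul]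
    exact mul_nonneg (Nat.cast_nonneg _) (hoff j i hji)

/-- **RESTRICTION LEMMA** (memo K-PCC Lemma 4.1): if `Z` is anti-nef pointed at `t` for the whole configuration,
then `Z|_S` satisfies the pointed anti-nef inequalities AT EVERY CURVE OF `S` (i.e. for the principal submatrix).
[this work] -/
theorem indicator_isPointedAntinefOn {M : ι → ι → ℤ} (hoff : ∀ i j, i ≠ j → 0 ≤ M i j) (t : ι) {Z : ι → ℕ}
    (hZ : ∀ i, ∑ j, (Z j : ℤ) * M j i ≤ -(if i = t then 1 else 0)) (S : Finset ι) :
    ∀ i ∈ S, ∑ j, ((Set.indicator (↑S) Z) j : ℤ) * M j i ≤ -(if i = t then 1 else 0) :=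
  fun _ hi => (sum_indicator_mul_le M hoff S Z hi).trans (hZ _)

/-- **`Z⁽ᵗ⁾_Γ|_S ≥ Z⁽ᵗ⁾_S` in usable form**: every common lower bound `P` (on `S`) of the `S`-supported cycles
satisfying the pointed anti-nef inequalities at the curves of `S` — e.g. their least element `Z⁽ᵗ⁾_S`, or, for an
`A_ℓ`-path with `t` its middle curve, the pyramid (`pyramid_le_of_concave_of_corner`) — lies below every
`Z ∈ 𝒫_t(Γ)` on `S`. [this work] -/
theorem le_of_isPointedAntinef_of_forall_le {M : ι → ι → ℤ} (hoff : ∀ i j, i ≠ j → 0 ≤ M i j) (t : ι)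
    (S : Finset ι) (P : ι → ℕ)
    (hP : ∀ W : ι → ℕ, (∀ i ∉ S, W i = 0) →
      (∀ i ∈ S, ∑ j, (W j : ℤ) * M j i ≤ -(if i = t then 1 else 0)) → ∀ i ∈ S, P i ≤ W i)
    {Z : ι → ℕ} (hZ : ∀ i, ∑ j, (Z j : ℤ) * M j i ≤ -(if i = t then 1 else 0)) : ∀ i ∈ S, P i ≤ Z i := by
  intro i hi
  have h := hP (Set.indicator (↑S) Z) (fun j hj => Set.indicator_of_notMem (fun h => hj (Finset.mem_coe.1 h)) Z)
    (indicator_isPointedAntinefOn hoff t hZ S) i hi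
  rwa [Set.indicator_of_mem (Finset.mem_coe.2 hi)] at h

end Restrict

/-! ## The pyramid lemma for an `A_ℓ`-path (memo K-PCC Rem 2.5 / Cor 4.4): on a path of (−2)-curves the
pointed anti-nef inequalities say that the profile `W : ℕ → ℤ` (virtual flank values `W 0`, `W (ℓ+1) ≥ 0`) is concave
with a strict corner at `t`. -/

section Chain

/-- **Slopes of a concave profile are antitone**: if `W (i−1) + W (i+1) ≤ 2·W i` for `1 ≤ i ≤ ℓ` then
`W b − W (b−1) ≤ W a − W (a−1)` for `1 ≤ a ≤ b ≤ ℓ+1`. [folklore] -/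
theorem slope_antitone_of_concave (ℓ : ℕ) (W : ℕ → ℤ)
    (hconc : ∀ i, 1 ≤ i → i ≤ ℓ → W (i - 1) + W (i + 1) ≤ 2 * W i) :
    ∀ a b, 1 ≤ a → a ≤ b → b ≤ ℓ + 1 → W b - W (b - 1) ≤ W a - W (a - 1) := by
  intro a b ha hab hb
  induction b, hab using Nat.le_induction with
  | base => exact le_rfl
  | succ b hab ih =>
    have h1 := ih (by omega)
    have h2 := hconc b (by omega) (by omega)
    have h3 : W (b + 1) - W (b + 1 - 1) ≤ W b - W (b - 1) := by
      rw [Nat.add_sub_cancel]; linarith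
    exact h3.trans h1

/-- If every slope on `(a, b]` is `≥ 1` then `W a + (b − a) ≤ W b`. [folklore] -/
theorem add_le_of_slopes_ge_one (W : ℕ → ℤ) (a b : ℕ) (hab : a ≤ b)
    (h : ∀ m, a + 1 ≤ m → m ≤ b → 1 ≤ W m - W (m - 1)) : W a + ((b : ℤ) - a) ≤ W b := by
  induction b, hab using Nat.le_induction with
  | base => simp
  | succ b hab ih =>
    have h1 := ih fun m hm1 hm2 => h m hm1 (by omega)
    have h2 := h (b + 1) (by omega) le_rfl
    rw [Nat.add_sub_cancel] at h2
    push_cast; linarith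

/-- If every slope on `(a, b]` is `≤ −1` then `W b ≤ W a − (b − a)`. [folklore] -/
theorem le_sub_of_slopes_le_neg_one (W : ℕ → ℤ) (a b : ℕ) (hab : a ≤ b)
    (h : ∀ m, a + 1 ≤ m → m ≤ b → W m - W (m - 1) ≤ -1) : W b ≤ W a - ((b : ℤ) - a) := by
  induction b, hab using Nat.le_induction with
  | base => simp
  | succ b hab ih =>
    have h1 := ih fun m hm1 hm2 => h m hm1 (by omega)
    have h2 := h (b + 1) (by omega) le_rfl
    rw [Nat.add_sub_cancel] at h2
    push_cast; linarith

/-- If every slope on `(a, b]` is `≥ 0` then `W a ≤ W b`. [folklore] -/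
theorem le_of_slopes_nonneg (W : ℕ → ℤ) (a b : ℕ) (hab : a ≤ b)
    (h : ∀ m, a + 1 ≤ m → m ≤ b → 0 ≤ W m - W (m - 1)) : W a ≤ W b := by
  induction b, hab using Nat.le_induction with
  | base => exact le_rfl
  | succ b hab ih =>
    have h1 := ih fun m hm1 hm2 => h m hm1 (by omega)
    have h2 := h (b + 1) (by omega) le_rfl
    rw [Nat.add_sub_cancel] at h2
    linarith

/-- If every slope on `(a, b]` is `≤ 0` then `W b ≤ W a`. [folklore] -/
theorem le_of_slopes_nonpos (W : ℕ → ℤ) (a b : ℕ) (hab : a ≤ b)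
    (h : ∀ m, a + 1 ≤ m → m ≤ b → W m - W (m - 1) ≤ 0) : W b ≤ W a := by
  induction b, hab using Nat.le_induction with
  | base => exact le_rfl
  | succ b hab ih =>
    have h1 := ih fun m hm1 hm2 => h m hm1 (by omega)
    have h2 := h (b + 1) (by omega) le_rfl
    rw [Nat.add_sub_cancel] at h2
    linarith

/-- **PYRAMID LEMMA** (memo K-PCC Rem 2.5 / Cor 4.4; the chain's «K-S-ii in numbers» threshold met automatically).
Let `W : ℕ → ℤ` be a profile on `0,…,ℓ+1` with non-negative end values `W 0, W (ℓ+1) ≥ 0` (the flanking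
coefficients, or `0` for a bare path), CONCAVE on `1..ℓ` (`W (i−1) + W (i+1) ≤ 2·W i`: the pointed anti-nef
inequalities for (−2)-curves meeting in a path, extra neighbours only strengthening them) and with a STRICT CORNER
at a middle index `t` (`W (t−1) + W (t+1) ≤ 2·W t − 1`, `ℓ ≤ 2t ≤ ℓ+2`).  Then `W` dominates the pyramid of
`A_ℓ`: `min(i, ℓ+1−i) ≤ W i` for `1 ≤ i ≤ ℓ` — the cycle of `ca(A_ℓ) = (u, v, w^{⌈ℓ/2⌉})`.  Proof: slopes are
antitone with a drop `≥ 1` after `t`; either all slopes up to `t` are `≥ 1` (then `W i ≥ i` up to `t`; beyond `t`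
either the slopes have turned `≤ −1`, giving `W i ≥ ℓ+1−i` from the right end, or `W` is still non-decreasing and
`W i ≥ W t ≥ t ≥ ℓ+1−i`), or all slopes after `t` are `≤ −1` (the mirror argument). [this work] -/
theorem pyramid_le_of_concave_of_corner (ℓ t : ℕ) (W : ℕ → ℤ) (h0 : 0 ≤ W 0) (hl : 0 ≤ W (ℓ + 1))
    (ht1 : 1 ≤ t) (ht2 : t ≤ ℓ) (hmid1 : ℓ ≤ 2 * t) (hmid2 : 2 * t ≤ ℓ + 2)
    (hconc : ∀ i, 1 ≤ i → i ≤ ℓ → W (i - 1) + W (i + 1) ≤ 2 * W i)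
    (hcorner : W (t - 1) + W (t + 1) ≤ 2 * W t - 1) :
    ∀ i, 1 ≤ i → i ≤ ℓ → ((min i (ℓ + 1 - i) : ℕ) : ℤ) ≤ W i := by
  have anti := slope_antitone_of_concave ℓ W hconc
  -- the drop at the corner: slope (t+1) ≤ slope t − 1
  have hdrop : W (t + 1) - W t ≤ W t - W (t - 1) - 1 := by linarith
  intro i hi1 hi2
  have hmin_le_i : (((min i (ℓ + 1 - i) : ℕ) : ℤ)) ≤ (i : ℤ) := by exact_mod_cast min_le_left _ _
  have hmin_le_r : (((min i (ℓ + 1 - i) : ℕ) : ℤ)) ≤ ((ℓ + 1 - i : ℕ) : ℤ) := by exact_mod_cast min_le_right _ _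
  have hcast_r : ((ℓ + 1 - i : ℕ) : ℤ) = (ℓ : ℤ) + 1 - i := by rw [Nat.cast_sub (by omega)]; push_cast; ring
  by_cases hs : 1 ≤ W t - W (t - 1)
  · -- Case 1: every slope up to `t` is ≥ 1
    have hup : ∀ m, 0 + 1 ≤ m → m ≤ t → 1 ≤ W m - W (m - 1) := fun m hm1 hm2 =>
      hs.trans (anti m t (by omega) hm2 (by omega))
    by_cases hit : i ≤ t
    · -- before the corner: W i ≥ i
      have h := add_le_of_slopes_ge_one W 0 i (by omega) fun m hm1 hm2 => hup m hm1 (by omega)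
      have : (i : ℤ) ≤ W i := by push_cast at h; linarith
      exact hmin_le_i.trans this
    · -- after the corner
      push Not at hit
      by_cases hs2 : W (i + 1) - W i ≤ -1
      · -- slopes from i+1 on are ≤ −1: come down from the right end
        have hdown : ∀ m, i + 1 ≤ m → m ≤ ℓ + 1 → W m - W (m - 1) ≤ -1 := fun m hm1 hm2 => by
          have := anti (i + 1) m (by omega) hm1 hm2
          rw [Nat.add_sub_cancel] at this; linarith
        have h := le_sub_of_slopes_le_neg_one W i (ℓ + 1) (by omega) hdown
        have : ((ℓ + 1 - i : ℕ) : ℤ) ≤ W i := by rw [hcast_r]; push_cast at h; linarith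
        exact hmin_le_r.trans this
      · -- slope (i+1) ≥ 0, hence all slopes on (t, i] are ≥ 0 and W i ≥ W t ≥ t ≥ ℓ+1−i
        push Not at hs2
        have hnn : ∀ m, t + 1 ≤ m → m ≤ i → 0 ≤ W m - W (m - 1) := fun m hm1 hm2 => by
          have := anti m (i + 1) (by omega) (by omega) (by omega)
          rw [Nat.add_sub_cancel] at this; linarith
        have hti : W t ≤ W i := le_of_slopes_nonneg W t i (by omega) hnn
        have hWt : (t : ℤ) ≤ W t := by
          have h := add_le_of_slopes_ge_one W 0 t (by omega) hup
          push_cast at h; linarith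
        have hr : ((ℓ + 1 - i : ℕ) : ℤ) ≤ (t : ℤ) := by exact_mod_cast (show ℓ + 1 - i ≤ t by omega)
        exact hmin_le_r.trans (hr.trans (hWt.trans hti))
  · -- Case 2: the slope at `t` is ≤ 0, so every slope after `t` is ≤ −1
    push Not at hs
    have hdown : ∀ m, t + 1 ≤ m → m ≤ ℓ + 1 → W m - W (m - 1) ≤ -1 := fun m hm1 hm2 => by
      have := anti (t + 1) m (by omega) hm1 hm2
      rw [Nat.add_sub_cancel] at this; linarith
    by_cases hit : t ≤ i
    · -- after the corner: come down from the right end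
      have h := le_sub_of_slopes_le_neg_one W i (ℓ + 1) (by omega) fun m hm1 hm2 => hdown m (by omega) hm2
      have : ((ℓ + 1 - i : ℕ) : ℤ) ≤ W i := by rw [hcast_r]; push_cast at h; linarith
      exact hmin_le_r.trans this
    · push Not at hit
      by_cases hs2 : 1 ≤ W i - W (i - 1)
      · -- slopes up to i are ≥ 1: W i ≥ i
        have hup : ∀ m, 0 + 1 ≤ m → m ≤ i → 1 ≤ W m - W (m - 1) := fun m hm1 hm2 =>
          hs2.trans (anti m i (by omega) hm2 (by omega))
        have h := add_le_of_slopes_ge_one W 0 i (by omega) hup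
        have : (i : ℤ) ≤ W i := by push_cast at h; linarith
        exact hmin_le_i.trans this
      · -- slope i ≤ 0: W is non-increasing on [i−1, t], so W i ≥ W t ≥ ℓ+1−t ≥ i
        push Not at hs2
        have hnp : ∀ m, i + 1 ≤ m → m ≤ t → W m - W (m - 1) ≤ 0 := fun m hm1 hm2 => by
          have := anti i m (by omega) (by omega) (by omega)
          linarith
        have hti : W t ≤ W i := le_of_slopes_nonpos W i t (by omega) hnp
        have hWt : (ℓ : ℤ) + 1 - t ≤ W t := by
          have h := le_sub_of_slopes_le_neg_one W t (ℓ + 1) (by omega) hdown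
          push_cast at h; linarith
        have hr : (i : ℤ) ≤ (ℓ : ℤ) + 1 - t := by
          have : i + t ≤ ℓ + 1 := by omega
          have : ((i + t : ℕ) : ℤ) ≤ ((ℓ + 1 : ℕ) : ℤ) := by exact_mod_cast this
          push_cast at this; linarith
        exact hmin_le_i.trans (hr.trans (hWt.trans hti))

end Chain

end Summit.ResolutionOfSingularities.ResolutionOfSingularities.Theorems.HomologicalConductor.PersistencePointedCycles
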